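import Summits.QuantumFields.BalabanUV.Beta.GAN24.SoftColumnOrderZeroChain
import Summits.QuantumFields.BalabanUV.T4Continuum.Support.BalabanAveragedCoerciveTower
import Summits.QuantumFields.BalabanUV.T4Continuum.Support.BalabanHardMinimizer

/-!
# `BalabanUV.Beta.GAN24.HardColumnChains` — binder row G-an2-4 ∕ (CONV-C), route R7 «TWO CURRENCIES», S4 ON THE HARD LEGS: the
# CONSTRAINED minimiser `H_k = 𝒢Q*(Q𝒢Q*)⁻¹` ([Balaban1984PropagatorsII] (2.35), the `H_k` of (CONV-C)'s list) as a leg tower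
# `M̂_k = M̃_k·Λ_k` = «soft ∘ (unit factor)», its one-step law in `ℓ²`, its H¹ bound, and the two operator-slot chains
# `⟨H_ke_p, 𝒢_kH_ke_r⟩`, `⟨∇_μH_ke_p, 𝒢_k∇_{μ′}H_ke_r⟩` entrywise Cauchy at rate `L^{−k}` — UNCONDITIONALLY

NOT IN PRINT; OUR PROOF ATTEMPT (prover part P3 of row G-an2-4, fibre∕strip («Woodbury») lineage, gen 26; CRUX TEAM (2), ruling «YM
REDIRECT TOWARDS THE SUMMIT», 2026-08-21).  HONEST DEPENDENCY (cell records, verbatim): «continuum YM on T⁴ ⇐ BetaPertH ∧ nine spine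
estimates (0/9 proved); BetaPertH ⇐ (D1) ∧ (D4) ∧ CAP+tail; G-an2-4 gates asym, D1 and NE2/3/4.»  HONEST FRAMING (cell contract, verbatim):
«discharging `BetaPertH` makes Bałaban's UV stability UNCONDITIONAL — a real constructive-QFT result; it is NOT the continuum limit and NOT
the Clay problem.»  ABSOLUTE RULE: nothing printed is a hypothesis; no `def … : Prop`, no sorry; [folklore] algebra over TREE objects BY NAME.

## The item (`HOME/beta/ROUTES-GAN24.md` v8.1 §2 R7 S3 (ρ3) «value part … hard = soft ∘ (unit factor) by B5 (1.69) [PRINTED]» and «(ρ4) unit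
## factors `(Q_kG_kQ_k*)⁻¹` …»; `PRICING-GAN24.md` v3.8 check #44 (a)(ii) «soft → hard (the (U-SINV)-type unit-lattice factor)»)

Gens 25–26 executed R7-S4 on NE2-P1's SOFT legs `M̃_k = n_k^{d∕2}·a·𝒢_k·QBtow_kᴴ`.  The u-sector's legs are the HARD ones, `𝓗_ke_y` with
`𝓗 = H_k = 𝒢Q*(Q𝒢Q*)⁻¹` («A = HB = GQ*(QGQ*)^{−1}B», (2.35); `T4Continuum.BalabanHardMinimizer.Hk`).  Since `a·Q_kᴴ·(a⁻¹(n^dQ𝒢Qᴴ)⁻¹)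
= Q_kᴴ(Q𝒢Qᴴ… )⁻¹`, the hard leg map is the soft one composed with a UNIT-LATTICE factor:
 * §1 `Lam k := a⁻¹·(unitCovB k)⁻¹` (NE2-P1's averaged unit covariance `c_k = n_k^dQ_k𝒢_kQ_kᴴ`, `BalabanAveragedTowerUnit.unitCovB`):
   `‖Λ_k‖ ≤ a⁻¹γ⁻¹` (`CoerciveInverseTower.opNorm_inv_le_of_coercive` + `BalabanAveragedCoerciveTower.uniformCoercive_unitCovB`,
   `γ = gammaB d a`), `‖Λ_{k+1} − Λ_k‖ ≤ a⁻¹γ⁻²·CQB·L^{−k}` (`opNorm_inv_sub_inv_le` + `opNorm_unitCovB_succ_sub_le`) — (ρ4) BY NAME;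
 * §2 **`Mhat k := M̃_k·Λ_k`**: `‖M̂_k‖ ≤ Cst∕γ`, `‖∇_{k,μ}M̂_k‖ ≤ Cst∕γ` (H¹-bounded), and the ONE-STEP LAW **`opNorm_Mhat_succ_sub_le`**
   `‖M̂_{k+1} − J_kM̂_k‖ ≤ CHH·L^{−k}`, `CHH := CQH∕γ + Cst·CQB∕γ²` (`M̃′Λ′ − JM̃Λ = (M̃′ − JM̃)Λ′ + (JM̃)(Λ′ − Λ)`);
 * §3 **`Mhat_mulVec`**: `M̂_k·B = n_k^{−d∕2}·H_k(B ∘ unitIdx⁻¹)` — the hard leg IS Bałaban's (2.35) minimiser `BalabanHardMinimizer.Hk` at level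
   `n_k = L^k`, in the `L²(T_η)` normalisation, read through NE2-P1's carrier dictionary (`Atow_QBlev_eq_submatrix`, `unitCovB_eq_submatrix`);
   hence `QvOp·(M̂_kB) = n_k^{−d∕2}·(B ∘ unitIdx⁻¹)` («Q_kH_kB = B»);
 * §4 the chains: the generic covariance-slot lemma **`norm_legCovChain_sub_le`** (any legs; slot 3 by the SANDWICHED (ρ1)
   `SoftColumnCovarianceChain.opNorm_sandwich_calG_sub_le`) and the two HARD instances **`norm_hardCovChain_succ_sub_le`**
   (`W^𝒢 = M̂ᴴ𝒢M̂`, entries `⟨H_ke_p, 𝒢_kH_ke_r⟩·n_k^{−d}`) and **`norm_hardOzChain_succ_sub_le`** (`M̂ᴴ(∇ᴴ𝒢∇)M̂`, by gen 26's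
   `SoftColumnOrderZeroChain.norm_legChain_sub_le`) — both entrywise Cauchy at rate `L^{−k}` with constants `(d, a, L)` only, NO letter.

HONEST SCOPE.  MODEL chains on typed objects (no claim that they ARE Table-T rows: S1∕S7 are an2's ∕ p1's); `U = 1`; every torus, `L ≥ 1`,
`d ≥ 1` where the face law enters; the identification §3 is with `BalabanHardMinimizer.Hk` = «GQ*(QGQ*)^{−1}» WITHOUT the gauge clause
«R∂*A = 0» (that file's located residual: (1.95) for the concrete operators); supplier work on the route of record; zero on the D1 grid;
NOT (CONV-C) (a list), NOT (ρ5), NEVER «G-an2-4 closed», NOT NE2, NOT D1, NOT BetaPertH, NOT continuum, NOT Clay.  Locators (text only):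
[Balaban1984PropagatorsI] (1.65)–(1.71) p. 29, Prop. 1.1 (1.89) p. 33; [Balaban1984PropagatorsII] (2.35) p. 228; [King1986] Prop. 3.8 p. 664,
Lemma 4.5 (4.38) p. 674.  Provenance: prover-b2b-balaban-gan24-p3-g26-0 (unit `b2b-balaban-gan24-p3`, gen 26), 2026-08-21.
-/

noncomputable section

open scoped BigOperators ComplexConjugate Matrix Matrix.Norms.L2Operator
open Finset

namespace Summit.QuantumFields.BalabanUV.Beta.GAN24.HardColumnChains

open Literature.MathematicalPhysics.QuantumFieldTheory.Balaban1983to89.B5Prop11Plancherel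
open Literature.MathematicalPhysics.QuantumFieldTheory.Balaban1983to89.B5Block118 (QvOp)
open Literature.MathematicalPhysics.QuantumFieldTheory.Balaban1983to89.B5QGQ171Unit (covB)
open Literature.MathematicalPhysics.QuantumFieldTheory.Balaban1983to89.B5G183RateUnitTower (lev lev_neZero)
open Summit.QuantumFields.BalabanUV.T4Continuum
open Summit.QuantumFields.BalabanUV.T4Continuum.CovariantAveragingTower (Atow)
open Summit.QuantumFields.BalabanUV.T4Continuum.BalabanAveragedTowerUnit (idx lev_succ' one_le_lev' cast_lev' QBlev calGlev unitCovB
  opNorm_unitCovB_succ_sub_le)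
open Summit.QuantumFields.BalabanUV.T4Continuum.BalabanLineAverage (CQB CQB_nonneg)
open Summit.QuantumFields.BalabanUV.T4Continuum.BalabanMinimizerLaw
open Summit.QuantumFields.BalabanUV.T4Continuum.KingPairingPlantedLaw (CJ CJ_nonneg)
open Summit.QuantumFields.BalabanUV.T4Continuum.KingLaplacianConsistency (gradC gradF)
open Summit.QuantumFields.BalabanUV.T4Continuum.CoerciveInverseTower (Coercive opNorm_inv_le_of_coercive opNorm_inv_sub_inv_le)
open Summit.QuantumFields.BalabanUV.T4Continuum.BalabanAveragedCoercive (gammaB gammaB_pos)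
open Summit.QuantumFields.BalabanUV.T4Continuum.BalabanAveragedCoerciveTower (unitIdx uniformCoercive_unitCovB Atow_QBlev_eq_submatrix
  unitCovB_eq_submatrix natCast_lev)
open Summit.QuantumFields.BalabanUV.T4Continuum.BalabanHardMinimizer (cinv Hk QvOp_mulVec_Hk)
open Summit.QuantumFields.BalabanUV.Beta.GAN24.ChainLeibniz (norm_conjTranspose_mul_apply_le)
open Summit.QuantumFields.BalabanUV.Beta.GAN24.SoftColumnVertexRate (sqrt_pow_pos opNorm_Mtil_le)
open Summit.QuantumFields.BalabanUV.Beta.GAN24.SoftColumnCovarianceChain (calGsucc opNorm_calGsucc_le opNorm_sandwich_calG_sub_le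
  norm_conjTranspose_mul_mul_apply_le)
open Summit.QuantumFields.BalabanUV.Beta.GAN24.OrderZeroSlotLaw (CK CK_nonneg)
open Summit.QuantumFields.BalabanUV.Beta.GAN24.SoftColumnOrderZeroChain

variable {d : ℕ} (L : ℕ) [NeZero L] (M : Fin d → ℕ) [hM : ∀ μ, NeZero (M μ)] (a : ℝ) (ha : 0 < a)

/-! ## §1 The unit factor `Λ_k = a⁻¹·(n_k^dQ_k𝒢_kQ_kᴴ)⁻¹` ((ρ4) by name) -/

/-- **THE UNIT FACTOR** `Λ_k := a⁻¹·c_k⁻¹`, `c_k = n_k^d·Q_k𝒢_kQ_kᴴ` (NE2-P1's `unitCovB k`): the unit-lattice operator turning the soft leg map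
into the hard one, `M̂_k = M̃_k·Λ_k`. [cite: Balaban1984PropagatorsII, (2.35) p.228; Balaban1984PropagatorsI, (1.71) p.29] [folklore] -/
def Lam (k : ℕ) : Matrix (idx L M 0) (idx L M 0) ℂ := ((a : ℂ))⁻¹ • (unitCovB L M a ha k)⁻¹

/-- `‖Λ_k‖ ≤ a⁻¹·γ(d,a)⁻¹`, uniformly in `k` (uniform coercivity of the `c_k`, NE2-P1 gen 8). [folklore] -/
theorem opNorm_Lam_le (k : ℕ) : ‖Lam L M a ha k‖ ≤ a⁻¹ * (gammaB d a)⁻¹ := by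
  have h := opNorm_inv_le_of_coercive (gammaB_pos a ha) (uniformCoercive_unitCovB L M a ha k)
  rw [Lam, norm_smul, norm_inv, Complex.norm_real, Real.norm_of_nonneg ha.le]
  exact mul_le_mul_of_nonneg_left h (inv_nonneg.mpr ha.le)

/-- **`‖Λ_{k+1} − Λ_k‖ ≤ a⁻¹·γ⁻²·CQB·L^{−k}`** — the one-step law of the unit factor (resolvent identity on the coercive tower `c_k`,
`‖c_{k+1} − c_k‖ ≤ CQB·L^{−k}`). [cite: King1986, Lemma 4.5 (4.38) p.674 (shape)] [folklore] -/
theorem opNorm_Lam_succ_sub_le (k : ℕ) :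
    ‖Lam L M a ha (k + 1) - Lam L M a ha k‖ ≤ a⁻¹ * (((gammaB d a)⁻¹) ^ 2 * (CQB d a * ((L : ℝ)⁻¹) ^ k)) := by
  have h := opNorm_inv_sub_inv_le (gammaB_pos a ha) (uniformCoercive_unitCovB L M a ha (k + 1)) (uniformCoercive_unitCovB L M a ha k)
  have hs := opNorm_unitCovB_succ_sub_le L M a ha k
  rw [Lam, Lam, ← smul_sub, norm_smul, norm_inv, Complex.norm_real, Real.norm_of_nonneg ha.le]
  refine mul_le_mul_of_nonneg_left (h.trans ?_) (inv_nonneg.mpr ha.le)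
  exact mul_le_mul_of_nonneg_left hs (by positivity)

/-! ## §2 The hard leg map `M̂_k = M̃_k·Λ_k` and its three laws -/

/-- **THE HARD LEG MAP** `M̂_k := M̃_k·Λ_k` — `= n_k^{−d∕2}·H_k` (§3), Bałaban's constrained minimiser «A = HB = GQ*(QGQ*)^{−1}B» in the
`L²(T_η)` normalisation on NE2-P1's tower carriers. [cite: Balaban1984PropagatorsII, (2.35) p.228] [folklore] -/
def Mhat (k : ℕ) : Matrix (idx L M k) (idx L M 0) ℂ := Mtil L M a ha k * Lam L M a ha k

/-- `‖M̂_k‖ ≤ Cst·γ⁻¹`, uniformly in `k`. [folklore] -/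
theorem opNorm_Mhat_le (k : ℕ) : ‖Mhat L M a ha k‖ ≤ Cst d a * (gammaB d a)⁻¹ := by
  have e : (a * Cst d a) * (a⁻¹ * (gammaB d a)⁻¹) = Cst d a * (gammaB d a)⁻¹ := by field_simp
  rw [Mhat, ← e]
  exact (Matrix.l2_opNorm_mul _ _).trans (mul_le_mul (opNorm_Mtil_le L M a ha k) (opNorm_Lam_le L M a ha k) (norm_nonneg _)
    (mul_nonneg ha.le (Cst_nonneg d a)))

/-- **`‖∇_{k,μ}·M̂_k‖ ≤ Cst·γ⁻¹`**: the hard legs are H¹-BOUNDED, uniformly in `k`. [cite: Balaban1984PropagatorsI, Prop. 1.1 (1.89) p.33]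
[folklore] -/
theorem opNorm_grad_Mhat_le (k : ℕ) (μ : Fin d) : ‖gradC (lev L k) M μ * Mhat L M a ha k‖ ≤ Cst d a * (gammaB d a)⁻¹ := by
  have e : (a * Cst d a) * (a⁻¹ * (gammaB d a)⁻¹) = Cst d a * (gammaB d a)⁻¹ := by field_simp
  rw [Mhat, ← Matrix.mul_assoc, ← e]
  exact (Matrix.l2_opNorm_mul _ _).trans (mul_le_mul (opNorm_grad_Mtil_le L M a ha k μ) (opNorm_Lam_le L M a ha k) (norm_nonneg _)
    (mul_nonneg ha.le (Cst_nonneg d a)))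

omit hM in
/-- the constant of the hard one-step law: `CHH := CQH·γ⁻¹ + Cst·γ⁻²·CQB`; OURS. [folklore] -/
def CHH (d : ℕ) (a : ℝ) : ℝ := CQH d a * (gammaB d a)⁻¹ + Cst d a * (((gammaB d a)⁻¹) ^ 2 * CQB d a)

omit hM in
include ha in
/-- `0 ≤ CHH` (`a > 0`). [folklore] -/
theorem CHH_nonneg : 0 ≤ CHH d a := by
  have := CQH_nonneg d a; have := Cst_nonneg d a; have := CQB_nonneg d a; have := (gammaB_pos (d := d) a ha).le
  unfold CHH; positivity

/-- **ONE STEP OF THE HARD MINIMISER TOWER** (`U = 1`, every `L ≥ 1`): `‖M̂_{k+1} − J_kM̂_k‖ ≤ CHH(d,a)·L^{−k}` — from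
`M̃′Λ′ − JM̃Λ = (M̃′ − JM̃)Λ′ + (JM̃)(Λ′ − Λ)`, the soft law `opNorm_Mtil_succ_sub_le` and §1: the shape of [King1986] Prop. 3.8 (3.71) for
the CONSTRAINED minimiser, in operator norm, for Bałaban's vector objects.  Statement and constant OURS. [cite: King1986, Prop. 3.8 (3.71)
p.664; Balaban1984PropagatorsII, (2.35) p.228] [folklore] -/
theorem opNorm_Mhat_succ_sub_le (k : ℕ) :
    ‖atSucc' L M k (Mhat L M a ha (k + 1)) - Jpc L M k * Mhat L M a ha k‖ ≤ CHH d a * ((L : ℝ)⁻¹) ^ k := by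
  have hD := opNorm_Mtil_succ_sub_le L M a ha k
  have hΛ' := opNorm_Lam_le L M a ha (k + 1)
  have hΛd := opNorm_Lam_succ_sub_le L M a ha k
  have hJM : ‖Jpc L M k * Mtil L M a ha k‖ ≤ a * Cst d a :=
    (Matrix.l2_opNorm_mul _ _).trans ((mul_le_mul (opNorm_Jpc_le L M k) (opNorm_Mtil_le L M a ha k) (norm_nonneg _) zero_le_one).trans
      (le_of_eq (one_mul _)))
  have hγ := (gammaB_pos (d := d) a ha).le
  have e : atSucc' L M k (Mhat L M a ha (k + 1)) - Jpc L M k * Mhat L M a ha k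
      = (atSucc' L M k (Mtil L M a ha (k + 1)) - Jpc L M k * Mtil L M a ha k) * Lam L M a ha (k + 1)
        + Jpc L M k * Mtil L M a ha k * (Lam L M a ha (k + 1) - Lam L M a ha k) := by
    rw [Matrix.sub_mul, Matrix.mul_sub, Matrix.mul_assoc (Jpc L M k) (Mtil L M a ha k) (Lam L M a ha k)]
    show atSucc' L M k (Mtil L M a ha (k + 1)) * Lam L M a ha (k + 1) - Jpc L M k * (Mtil L M a ha k * Lam L M a ha k) = _
    abel
  rw [e]
  calc _ ≤ ‖(atSucc' L M k (Mtil L M a ha (k + 1)) - Jpc L M k * Mtil L M a ha k) * Lam L M a ha (k + 1)‖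
          + ‖Jpc L M k * Mtil L M a ha k * (Lam L M a ha (k + 1) - Lam L M a ha k)‖ := norm_add_le _ _
    _ ≤ (a * CQH d a * ((L : ℝ)⁻¹) ^ k) * (a⁻¹ * (gammaB d a)⁻¹)
          + (a * Cst d a) * (a⁻¹ * (((gammaB d a)⁻¹) ^ 2 * (CQB d a * ((L : ℝ)⁻¹) ^ k))) := by
        refine add_le_add ?_ ?_
        · exact (Matrix.l2_opNorm_mul _ _).trans (mul_le_mul hD hΛ' (norm_nonneg _) ((norm_nonneg _).trans hD))
        · exact (Matrix.l2_opNorm_mul _ _).trans (mul_le_mul hJM hΛd (norm_nonneg _) (mul_nonneg ha.le (Cst_nonneg d a)))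
    _ = CHH d a * ((L : ℝ)⁻¹) ^ k := by rw [CHH]; field_simp

/-! ## §3 The hard leg IS Bałaban's (2.35) minimiser `H_k` -/

/-- **`M̂_k·B = n_k^{−d∕2}·H_kB′`**, `B′ = B ∘ unitIdx⁻¹` — the hard leg map is `BalabanHardMinimizer.Hk` («A = HB = GQ*(QGQ*)^{−1}B») at
level `n_k = L^k` in the `L²(T_η)` normalisation, through NE2-P1's dictionary `QBtow_k = Q_k ∘ unitIdx`, `unitCovB k = covB ∘ unitIdx`.
[cite: Balaban1984PropagatorsII, (2.35) p.228] [folklore] -/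
theorem Mhat_mulVec (k : ℕ) (B : idx L M 0 → ℂ) :
    Mhat L M a ha k *ᵥ B
      = (((Real.sqrt (((L : ℝ) ^ d) ^ k))⁻¹ : ℝ) : ℂ) • Hk (lev L k) (one_le_lev' L k) M a ha (B ∘ (unitIdx L M).symm) := by
  have hs0 := sqrt_pow_pos (d := d) L k
  have hsC : (((Real.sqrt (((L : ℝ) ^ d) ^ k)) : ℝ) : ℂ) ≠ 0 := by exact_mod_cast hs0.ne'
  have haC : ((a : ℂ)) ≠ 0 := by exact_mod_cast ha.ne'
  have hss : (((Real.sqrt (((L : ℝ) ^ d) ^ k)) : ℝ) : ℂ) * (((Real.sqrt (((L : ℝ) ^ d) ^ k)) : ℝ) : ℂ)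
      = (((lev L k : ℕ) : ℂ)) ^ d := by
    rw [← Complex.ofReal_mul, Real.mul_self_sqrt (pow_nonneg (pow_nonneg (Nat.cast_nonneg _) d) k), natCast_lev, ← pow_mul, ← pow_mul,
      mul_comm k d]
    push_cast; rfl
  -- NE2-P1's carrier dictionary
  have hA : (Atow (QBlev L M) k)ᴴ = ((QvOp (lev L k) M)ᴴ).submatrix id (unitIdx L M) := by
    rw [Atow_QBlev_eq_submatrix, Matrix.conjTranspose_submatrix]
  have hΛ : (unitCovB L M a ha k)⁻¹ *ᵥ B
      = ((covB (lev L k) (one_le_lev' L k) M a ha)⁻¹ *ᵥ (B ∘ (unitIdx L M).symm)) ∘ (unitIdx L M) := by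
    rw [unitCovB_eq_submatrix, Matrix.inv_submatrix_equiv, Matrix.submatrix_mulVec_equiv]
  -- the left side
  have hL : Mhat L M a ha k *ᵥ B = (((a : ℂ))⁻¹ * ((((Real.sqrt (((L : ℝ) ^ d) ^ k)) * a : ℝ) : ℂ)))
      • (calGlev L M a ha k *ᵥ ((QvOp (lev L k) M)ᴴ *ᵥ ((covB (lev L k) (one_le_lev' L k) M a ha)⁻¹ *ᵥ (B ∘ (unitIdx L M).symm)))) := by
    rw [Mhat, Lam, ← Matrix.mulVec_mulVec, Matrix.smul_mulVec, Matrix.mulVec_smul, hΛ, Mtil, Matrix.smul_mulVec,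
      ← Matrix.mulVec_mulVec, hA, Matrix.submatrix_mulVec_equiv, Function.comp_id, Function.comp_assoc, Equiv.self_comp_symm,
      Function.comp_id, smul_smul]
  -- the right side
  have hR : Hk (lev L k) (one_le_lev' L k) M a ha (B ∘ (unitIdx L M).symm) = ((((lev L k : ℕ) : ℂ)) ^ d)
      • (calGlev L M a ha k *ᵥ ((QvOp (lev L k) M)ᴴ *ᵥ ((covB (lev L k) (one_le_lev' L k) M a ha)⁻¹ *ᵥ (B ∘ (unitIdx L M).symm)))) := by
    rw [Hk, cinv, Matrix.smul_mulVec, Matrix.mulVec_smul, Matrix.mulVec_smul, calGlev]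
  rw [hL, hR, smul_smul]
  congr 1
  rw [← hss]
  push_cast
  field_simp

/-- «Q_kH_kB = B» for the hard legs: `Q_k·(M̂_kB) = n_k^{−d∕2}·B′` — the hard leg map lands in the admissible class.
[cite: Balaban1984PropagatorsI, p.29] [folklore] -/
theorem QvOp_mulVec_Mhat (k : ℕ) (B : idx L M 0 → ℂ) :
    QvOp (lev L k) M *ᵥ (Mhat L M a ha k *ᵥ B)
      = (((Real.sqrt (((L : ℝ) ^ d) ^ k))⁻¹ : ℝ) : ℂ) • (B ∘ (unitIdx L M).symm) := by
  rw [Mhat_mulVec, Matrix.mulVec_smul, QvOp_mulVec_Hk]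

/-! ## §4 The operator-slot chains of the hard legs, unconditionally -/

section Generic

variable {κ κ' : Type*} [Fintype κ] [DecidableEq κ] [Fintype κ'] [DecidableEq κ']

/-- **THE COVARIANCE-SLOT CHAIN BETWEEN GENERIC LEGS IS CAUCHY**: for leg maps into levels `k+1` (`X₁, Y₁`) and `k` (`X₀, Y₀`) with
`‖X₁‖, ‖X₀‖, ‖Y₀‖ ≤ α` and one-step rates `‖X₁ − J_kX₀‖, ‖Y₁ − J_kY₀‖ ≤ ε`, every entry of `X₁ᴴ𝒢_{k+1}Y₁ − X₀ᴴ𝒢_kY₀` is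
`≤ 2·α·Cst·ε + α²·CJ·L^{−k}` (slot 3 = `X₀ᴴ(J_kᴴ𝒢_{k+1}J_k − 𝒢_k)Y₀`, the SANDWICHED (ρ1) `opNorm_sandwich_calG_sub_le`). [folklore] -/
theorem norm_legCovChain_sub_le (k : ℕ)
    (X₁ : Matrix (Tor (fine (L * lev L k) M) × Fin d) κ ℂ) (Y₁ : Matrix (Tor (fine (L * lev L k) M) × Fin d) κ' ℂ)
    (X₀ : Matrix (idx L M k) κ ℂ) (Y₀ : Matrix (idx L M k) κ' ℂ) {α ε : ℝ} (hα : 0 ≤ α) (hε : 0 ≤ ε)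
    (hX₁ : ‖X₁‖ ≤ α) (hX₀ : ‖X₀‖ ≤ α) (hY₀ : ‖Y₀‖ ≤ α) (hXr : ‖X₁ - Jpc L M k * X₀‖ ≤ ε) (hYr : ‖Y₁ - Jpc L M k * Y₀‖ ≤ ε)
    (p : κ) (r : κ') :
    ‖(X₁ᴴ * calGsucc L M a ha k * Y₁ - X₀ᴴ * calGlev L M a ha k * Y₀) p r‖
      ≤ 2 * (α * Cst d a * ε) + α * (CJ d a * ((L : ℝ)⁻¹) ^ k) * α := by
  have hG' : ‖calGsucc L M a ha k‖ ≤ Cst d a := opNorm_calGsucc_le L M a ha k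
  have hS := opNorm_sandwich_calG_sub_le L M a ha k
  have hCst := Cst_nonneg d a
  have hσ : 0 ≤ CJ d a * ((L : ℝ)⁻¹) ^ k := (norm_nonneg _).trans hS
  have hJY : ‖Jpc L M k * Y₀‖ ≤ α :=
    (Matrix.l2_opNorm_mul _ _).trans ((mul_le_mul (opNorm_Jpc_le L M k) hY₀ (norm_nonneg _) zero_le_one).trans (le_of_eq (one_mul _)))
  rw [legChain_sub_eq X₁ Y₁ X₀ Y₀ (calGsucc L M a ha k) (calGlev L M a ha k) (Jpc L M k), Matrix.add_apply, Matrix.add_apply]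
  have t1 : ‖(X₁ᴴ * calGsucc L M a ha k * (Y₁ - Jpc L M k * Y₀)) p r‖ ≤ α * Cst d a * ε :=
    (norm_conjTranspose_mul_mul_apply_le _ _ _ p r).trans
      (mul_le_mul (mul_le_mul hX₁ hG' (norm_nonneg _) hα) hYr (norm_nonneg _) (mul_nonneg hα hCst))
  have t2 : ‖((X₁ - Jpc L M k * X₀)ᴴ * calGsucc L M a ha k * (Jpc L M k * Y₀)) p r‖ ≤ ε * Cst d a * α :=
    (norm_conjTranspose_mul_mul_apply_le _ _ _ p r).trans
      (mul_le_mul (mul_le_mul hXr hG' (norm_nonneg _) hε) hJY (norm_nonneg _) (mul_nonneg hε hCst))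
  have t3 : ‖(X₀ᴴ * ((Jpc L M k)ᴴ * calGsucc L M a ha k * Jpc L M k - calGlev L M a ha k) * Y₀) p r‖
      ≤ α * (CJ d a * ((L : ℝ)⁻¹) ^ k) * α :=
    (norm_conjTranspose_mul_mul_apply_le _ _ _ p r).trans
      (mul_le_mul (mul_le_mul hX₀ hS (norm_nonneg _) hα) hY₀ (norm_nonneg _) (mul_nonneg hα hσ))
  calc _ ≤ ‖(X₁ᴴ * calGsucc L M a ha k * (Y₁ - Jpc L M k * Y₀)) p r
            + ((X₁ - Jpc L M k * X₀)ᴴ * calGsucc L M a ha k * (Jpc L M k * Y₀)) p r‖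
          + ‖(X₀ᴴ * ((Jpc L M k)ᴴ * calGsucc L M a ha k * Jpc L M k - calGlev L M a ha k) * Y₀) p r‖ := norm_add_le _ _
    _ ≤ (α * Cst d a * ε + ε * Cst d a * α) + α * (CJ d a * ((L : ℝ)⁻¹) ^ k) * α :=
        add_le_add ((norm_add_le _ _).trans (add_le_add t1 t2)) t3
    _ = 2 * (α * Cst d a * ε) + α * (CJ d a * ((L : ℝ)⁻¹) ^ k) * α := by ring

end Generic

/-- **THE COVARIANCE CHAIN OF THE HARD LEGS** `Ŵ^𝒢_k := M̂_kᴴ·𝒢_k·M̂_k` (entries `⟨M̂_ke_p, 𝒢_kM̂_ke_r⟩ = n_k^{−d}⟨H_ke_p, 𝒢_kH_ke_r⟩_{ℓ²}` = the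
physical `⟨𝓗e_p, 𝒢_k𝓗e_r⟩_{L²(T_η)}`). [folklore] -/
def hardCovChain (k : ℕ) : Matrix (idx L M 0) (idx L M 0) ℂ := (Mhat L M a ha k)ᴴ * calGlev L M a ha k * Mhat L M a ha k

/-- **THE HARD «leg · 𝒢 · leg» CHAIN IS ENTRYWISE CAUCHY AT RATE `L^{−k}`, UNCONDITIONALLY**:
`‖Ŵ^𝒢_{k+1}(p,r) − Ŵ^𝒢_k(p,r)‖ ≤ (2·(Cst∕γ)·Cst·CHH + (Cst∕γ)²·CJ)·L^{−k}`. [folklore] -/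
theorem norm_hardCovChain_succ_sub_le (k : ℕ) (p r : idx L M 0) :
    ‖(hardCovChain L M a ha (k + 1) - hardCovChain L M a ha k) p r‖
      ≤ (2 * ((Cst d a * (gammaB d a)⁻¹) * Cst d a * CHH d a)
          + (Cst d a * (gammaB d a)⁻¹) * CJ d a * (Cst d a * (gammaB d a)⁻¹)) * ((L : ℝ)⁻¹) ^ k := by
  have hα : 0 ≤ Cst d a * (gammaB d a)⁻¹ := mul_nonneg (Cst_nonneg d a) (inv_nonneg.mpr (gammaB_pos (d := d) a ha).le)
  have hD := opNorm_Mhat_succ_sub_le L M a ha k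
  have h := norm_legCovChain_sub_le L M a ha k (atSucc' L M k (Mhat L M a ha (k + 1))) (atSucc' L M k (Mhat L M a ha (k + 1)))
    (Mhat L M a ha k) (Mhat L M a ha k) hα ((norm_nonneg _).trans hD) (opNorm_Mhat_le L M a ha (k + 1)) (opNorm_Mhat_le L M a ha k)
    (opNorm_Mhat_le L M a ha k) hD hD p r
  refine (le_of_eq ?_).trans (h.trans (le_of_eq ?_))
  · rfl
  · ring

/-- **THE ORDER-ZERO-SLOT CHAIN OF THE HARD LEGS** `Ŵ^R_k(μ,μ′) := M̂_kᴴ·(∇_{k,μ}ᴴ𝒢_k∇_{k,μ′})·M̂_k` (entries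
`n_k^{−d}⟨∇_μH_ke_p, 𝒢_k∇_{μ′}H_ke_r⟩`). [folklore] -/
def hardOzChain (k : ℕ) (μ μ' : Fin d) : Matrix (idx L M 0) (idx L M 0) ℂ :=
  (Mhat L M a ha k)ᴴ * Rop L M a ha k μ μ' * Mhat L M a ha k

/-- **THE HARD «leg · ∇ᴴ𝒢∇ · leg» CHAIN IS ENTRYWISE CAUCHY AT RATE `L^{−k}`, UNCONDITIONALLY** (`d ≥ 1`):
`‖Ŵ^R_{k+1}(μ,μ′)(p,r) − Ŵ^R_k(μ,μ′)(p,r)‖ ≤ (2·(Cst∕γ)·Cst·CHH + (Cst∕γ)²·CK(d,L,a))·L^{−k}` — gen 26's generic (ρ2) lemma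
`SoftColumnOrderZeroChain.norm_legChain_sub_le` on the hard legs (H¹-bounded by `opNorm_grad_Mhat_le`). [folklore] -/
theorem norm_hardOzChain_succ_sub_le (hd : 1 ≤ d) (k : ℕ) (μ μ' : Fin d) (p r : idx L M 0) :
    ‖(hardOzChain L M a ha (k + 1) μ μ' - hardOzChain L M a ha k μ μ') p r‖
      ≤ (2 * ((Cst d a * (gammaB d a)⁻¹) * Cst d a * CHH d a)
          + (Cst d a * (gammaB d a)⁻¹) * (Cst d a * (gammaB d a)⁻¹) * CK d L a) * ((L : ℝ)⁻¹) ^ k := by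
  have hα : 0 ≤ Cst d a * (gammaB d a)⁻¹ := mul_nonneg (Cst_nonneg d a) (inv_nonneg.mpr (gammaB_pos (d := d) a ha).le)
  have hD := opNorm_Mhat_succ_sub_le L M a ha k
  have h := norm_legChain_sub_le L M a ha hd k μ μ' (atSucc' L M k (Mhat L M a ha (k + 1))) (atSucc' L M k (Mhat L M a ha (k + 1)))
    (Mhat L M a ha k) (Mhat L M a ha k) hα ((norm_nonneg _).trans hD) hα (opNorm_Mhat_le L M a ha (k + 1)) (opNorm_Mhat_le L M a ha k)
    hD hD (opNorm_grad_Mhat_le L M a ha k μ) (opNorm_grad_Mhat_le L M a ha k μ') p r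
  refine (le_of_eq ?_).trans (h.trans (le_of_eq ?_))
  · rfl
  · ring

end Summit.QuantumFields.BalabanUV.Beta.GAN24.HardColumnChains

end
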